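import Literature.AnabelianGeometry.SemiGraphs.ZariskiMainTheorem

/-!
# Proofs of [SemiAnbd] Lemma 1.3 (iii) and of "morphisms of finite graphs are proper"

Mochizuki, *Semi-graphs of anabelioids*, Publ. RIMS **42** (2006) 221–322, §1, Lemma 1.3 (iii) and
its proof, p. 17 [cite: MochizukiSemiAnbd2006, Lem. 1.3(iii) p.17]: "`φ` is an excision [or,
equivalently, a finite graph-covering] if and only if for each color `i` and at each vertex `v` of `G`,
the number of branches of color `i` that enter (respectively, leave) `v` is `= 1`. … Note that in
general, a morphism of finite graphs is always proper, hence is a finite graph-covering if and only if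
it is excisive."  This file DISCHARGES the named facts `SemiGraph.lemma_1_3_iii` and
`SemiGraph.lemma_1_3_iii'` of `ZariskiMainTheorem.lean` ("follow immediately by considering the local
structure of `H_n` at `v_H`").
-/

namespace Literature.AnabelianGeometry.SemiGraphs

namespace SemiGraph

open CategoryTheory

universe u

/-- In a graph every edge has verticial cardinality `2`. [cite: MochizukiSemiAnbd2006, §1 p.11] -/
theorem IsGraph.vertCard_eq_two {G : SemiGraph.{u}} (hG : G.IsGraph) (e : G.Edge) :
    G.vertCard e = 2 := by
  obtain ⟨b₁, b₂, hne, h₁, h₂, hall⟩ := G.two_branches e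
  rw [vertCard, Nat.card_eq_two_iff]
  refine ⟨⟨b₁, h₁, hG.abuts_isSome b₁⟩, ⟨b₂, h₂, hG.abuts_isSome b₂⟩,
    fun h => hne (congrArg Subtype.val h), ?_⟩
  ext b
  simp only [Set.mem_insert_iff, Set.mem_singleton_iff, Set.mem_univ, iff_true]
  rcases hall b.1 b.2.1 with h | h
  · exact Or.inl (Subtype.ext h)
  · exact Or.inr (Subtype.ext h)

/-- "a morphism of finite graphs is always proper" (proof of Lemma 1.3, p. 17) — in fact any morphism
between graphs is. [cite: MochizukiSemiAnbd2006, Lem. 1.3(iii) p.17] -/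
theorem IsGraph.isProper {G G' : SemiGraph.{u}} (hG : G.IsGraph) (hG' : G'.IsGraph) (φ : G ⟶ G') :
    IsProper φ :=
  fun e => by rw [hG.vertCard_eq_two, hG'.vertCard_eq_two]

/-- [SemiAnbd] proof of Lemma 1.3, p. 17: "a morphism of finite graphs is always proper, hence is a
finite graph-covering if and only if it is excisive" — PROVED, discharging `lemma_1_3_iii'`.
[cite: MochizukiSemiAnbd2006, Lem. 1.3(iii) p.17] -/
theorem lemma_1_3_iii'_holds : lemma_1_3_iii'.{u} := by
  intro G G' φ hG hGg hG' hG'g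
  refine ⟨hGg.isProper hG'g φ, ⟨fun h => h.1.2, fun h => ⟨⟨hGg.isProper hG'g φ, h⟩, ?_, ?_⟩⟩⟩
  · intro v'
    haveI := hG.finite_vertex
    exact Subtype.finite
  · intro e'
    haveI := hG.finite_edge
    exact Subtype.finite

/-- [SemiAnbd] Lemma 1.3 (iii): a morphism `φ : G → H_n` from a finite graph is an excision iff at each
vertex and for each colour exactly one branch enters and exactly one leaves — PROVED ("by considering
the local structure of `H_n` at `v_H`"), discharging `lemma_1_3_iii`.
[cite: MochizukiSemiAnbd2006, Lem. 1.3(iii) p.17] -/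
theorem lemma_1_3_iii_holds : lemma_1_3_iii.{u} := by
  intro G n φ _ _
  constructor
  · intro hφ v i dir
    rw [colourDegree, Nat.card_eq_one_iff_unique]
    refine ⟨⟨fun x y => Subtype.ext ((hφ v).1 (Subtype.ext ?_))⟩, ?_⟩
    · exact congrArg ULift.up (x.2.trans y.2.symm)
    · obtain ⟨b, hb⟩ := (hφ v).2 ⟨⟨(i, dir)⟩, rfl⟩
      exact ⟨⟨b, congrArg (fun x : (bouquet.{u} n).Star PUnit.unit => x.1.down) hb⟩⟩
  · intro h v
    constructor
    · intro x y hxy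
      have hval : φ.branchMap x.1 = φ.branchMap y.1 := congrArg Subtype.val hxy
      have hc := h v (φ.branchMap x.1).down.1 (φ.branchMap x.1).down.2
      rw [colourDegree, Nat.card_eq_one_iff_unique] at hc
      have := hc.1.elim ⟨x, rfl⟩ ⟨y, by rw [← hval]⟩
      exact congrArg Subtype.val this
    · rintro ⟨c, hc⟩
      have h1 := h v c.down.1 c.down.2
      rw [colourDegree, Nat.card_eq_one_iff_unique] at h1
      obtain ⟨⟨b, hb⟩⟩ := h1.2
      refine ⟨b, Subtype.ext ?_⟩
      change φ.branchMap b.1 = c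
      exact congrArg ULift.up hb

end SemiGraph

end Literature.AnabelianGeometry.SemiGraphs
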